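import Literature.Geometry.Symplectic.McleanStokesPointwise
import Literature.Geometry.Symplectic.SymplecticWedgeSquare
import Literature.Geometry.Symplectic.McleanDivisorComplementConvexFourGluing
import Literature.Geometry.Manifold.ShellCutoff
import Literature.Geometry.Manifold.SmulTopFormNotExact
import Literature.Geometry.Kaehler.OpensExtendReal
import Literature.Geometry.Kaehler.PluriharmonicLog
import Literature.Geometry.Kaehler.ManifoldFormsFunSmulProofs
import Literature.Geometry.Kaehler.MayerVietoris
import HarnessLib

/-!
# McLean's sign of the wrapping number: `κ < 0` by a cut-off Stokes argument

Topic `Literature/Geometry/Symplectic`; the global step "(d)" of the fact seat of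
`Literature.Geometry.Symplectic.mclean_divisorComplement_convex_four` (M. McLean, *The growth
rate of symplectic homology and affine varieties*, GAFA 22 (2012), Lemma 5.17 with Lemma 5.14,
case of one smooth component `k = 1`).

McLean's Lemma 5.17 assumes that the primitive `θ` of `ω` on the divisor complement `U = N ∖ B`
has *negative wrapping number* `κ` around `B`; for a closed symplectic `4`-manifold `N` and an
exact `ω|_U` this is automatic, and this file proves it in the normal form produced by the tree's
`exists_tube_normalForm` (`McleanTubeNormalForm.lean`): on the shell `{ε ≤ r² ≤ 2ε}` of the tube,
`(θ - dh)(X) = κ₀ + r²/2` for the rotation field `X` (`ω(X, ·) = -½ d r²`).  **Claim: `κ₀ < 0`**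
(`wrappingNumber_neg`).

Proof (the printed argument "integrate `d(χ θ' ∧ ω)` over `N`", made pointwise): let
`χ = φ(r²)` be a monotone cut-off, `0` for `r² ≤ ε`, `1` for `r² ≥ 2ε` (extended by `1` away from
the tube; `Literature.Geometry.Manifold.exists_shell_cutoff`), `θ' = θ - dh` on `U`, and
`η = χ · θ' ∧ ω`, a smooth `3`-form on `U` vanishing near `B`, extended by zero to `N`
(`MForm.extendOpensReal`).  Then `dη = dχ ∧ θ' ∧ ω + χ ω ∧ ω` (Leibniz rules
`mextDeriv_fun_smul_apply`, `mextDeriv_wedge`, `dθ' = ω`, `dω = 0`), and on the shell the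
pointwise identity `dχ ∧ θ' ∧ ω = φ'(r²) θ'(X) · ω ∧ ω` holds
(`wedgeOne_wedge_eq_smul_wedge_self`, from `dχ = φ'(r²) d r² = -2 φ'(r²) ω(X, ·)`), so
`dη = F · ω ∧ ω` with `F = χ + φ'(r²)(κ₀ + r²/2)`.  If `κ₀ ≥ 0` then `F ≥ 0` and `F = 1` far from
`B`, so the exact form `dη` would be a non-negative, somewhere positive multiple of the volume form
`ω ∧ ω` of the closed manifold `N` — impossible
(`MForm.not_mem_exactSmoothForms_smul_of_forall_ne_zero`, Stokes).  Hence `κ₀ < 0`.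

Everything is proved; no definitions, no named facts (D-0026).

## References

* M. McLean, *The growth rate of symplectic homology and affine varieties*, Geom. Funct. Anal. 22
  (2012), 369–442, Lemma 5.14, Lemma 5.17. [Mclean2012]
-/

noncomputable section

open scoped Manifold ContDiff Topology
open Set Function Filter
open Literature.Geometry.Kaehler Literature.Geometry.Manifold Literature.NumberTheory.Transcendental
  Literature.LinearAlgebra.Alternating

namespace Literature.Geometry.Symplectic

variable {N : Type*} [TopologicalSpace N] [T2Space N] [CompactSpace N]
  [ChartedSpace (EuclideanSpace ℝ (Fin 4)) N] [IsManifold (𝓡 4) ∞ N]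

omit [T2Space N] [CompactSpace N] [IsManifold (𝓡 4) ∞ N] in
/-- Differential of `c · f` along an open inclusion: for `x` in the open submanifold `W` and `f`
differentiable at `x`, `D(y ↦ c f(y))|_W (x) w = c · Df(x) w`. [folklore] -/
private theorem mfderiv_const_mul_comp_val {W : TopologicalSpace.Opens N} {f : N → ℝ} (c : ℝ)
    (x : W) (hf : MDifferentiableAt (𝓡 4) 𝓘(ℝ, ℝ) f (x : N)) (w : EuclideanSpace ℝ (Fin 4)) :
    @id ℝ (mfderiv (𝓡 4) 𝓘(ℝ, ℝ) (fun y : W ↦ c * f (y : N)) x w) =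
      c * @id ℝ (mfderiv (𝓡 4) 𝓘(ℝ, ℝ) f (x : N) w) := by
  have hval : MDifferentiableAt (𝓡 4) (𝓡 4) (Subtype.val : W → N) x :=
    ((contMDiff_subtype_val (n := ∞)) x).mdifferentiableAt (by simp)
  have hcf : HasMFDerivAt (𝓡 4) 𝓘(ℝ, ℝ) (fun y : N ↦ c * f y) (x : N)
      (c • mfderiv (𝓡 4) 𝓘(ℝ, ℝ) f (x : N)) := hf.hasMFDerivAt.const_smul c
  have hcomp : mfderiv (𝓡 4) 𝓘(ℝ, ℝ) (fun y : W ↦ c * f (y : N)) x =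
      (c • mfderiv (𝓡 4) 𝓘(ℝ, ℝ) f (x : N)).comp
        (mfderiv (𝓡 4) (𝓡 4) (Subtype.val : W → N) x) := by
    rw [show (fun y : W ↦ c * f (y : N)) = (fun y : N ↦ c * f y) ∘ Subtype.val from rfl,
      mfderiv_comp x hcf.mdifferentiableAt hval, hcf.mfderiv]
    rfl
  rw [hcomp, OpenSubmanifold.mfderiv_subtype_val]
  rfl

omit [T2Space N] [CompactSpace N] [IsManifold (𝓡 4) ∞ N] in
/-- Differential along an open inclusion: `D(f|_W)(x) w = Df(x) w`. [folklore] -/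
private theorem mfderiv_comp_val_real {W : TopologicalSpace.Opens N} {f : N → ℝ}
    (x : W) (hf : MDifferentiableAt (𝓡 4) 𝓘(ℝ, ℝ) f (x : N)) (w : EuclideanSpace ℝ (Fin 4)) :
    mfderiv (𝓡 4) 𝓘(ℝ, ℝ) (f ∘ Subtype.val) x w = mfderiv (𝓡 4) 𝓘(ℝ, ℝ) f (x : N) w := by
  have hval : MDifferentiableAt (𝓡 4) (𝓡 4) (Subtype.val : W → N) x :=
    ((contMDiff_subtype_val (n := ∞)) x).mdifferentiableAt (by simp)
  rw [mfderiv_comp x hf hval, OpenSubmanifold.mfderiv_subtype_val]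
  rfl

/-- **The wrapping number is negative** (McLean (2012), Lemma 5.17 with Lemma 5.14, `k = 1`,
`N` closed): in the normal form `(θ - dh)(X) = κ₀ + r²/2` on a shell `{ε ≤ r² ≤ 2ε}` of the tube
around the divisor (`ω(X, ·) = -½ d r²` there), with `ω` closed, pointwise nondegenerate and
exact on the divisor complement `U`, one has `κ₀ < 0` (the correction `h` need only be smooth at
the points of `U`). [cite: Mclean2012, Lemma 5.17] -/
theorem wrappingNumber_neg (s : MForm (𝓡 4) N ℝ 2) (hs : s ∈ closedSmoothForms (𝓡 4) N ℝ 2)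
    (hnd : ∀ (x : N) (v : TangentSpace (𝓡 4) x), v ≠ 0 →
      ∃ w : TangentSpace (𝓡 4) x, s x ![v, w] ≠ 0)
    {U W : TopologicalSpace.Opens N} (hWU : W ≤ U) (θ : MForm (𝓡 4) U ℝ 1)
    (hθ : IsSmoothForm θ) (hdθ : mextDeriv θ = s.pullback (𝓡 4) (Subtype.val : U → N))
    (X : W → EuclideanSpace ℝ (Fin 4)) (hX0 : ∀ x, X x ≠ 0) (r2 h : N → ℝ) {V : Set N}
    (hV : IsOpen V) (hUV : (U : Set N)ᶜ ⊆ V) (hr2 : ∀ x ∈ V, ContMDiffAt (𝓡 4) 𝓘(ℝ, ℝ) ∞ r2 x)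
    (hh : ∀ x ∈ (U : Set N), ContMDiffAt (𝓡 4) 𝓘(ℝ, ℝ) ∞ h x)
    (hr2U : ∀ x ∈ V, 0 < r2 x ↔ x ∈ U)
    (hT4 : ∀ (x : W) (w : EuclideanSpace ℝ (Fin 4)),
      s (x : N) ![X x, w] = mfderiv (𝓡 4) 𝓘(ℝ, ℝ) (fun y : W ↦ -(1 / 2) * r2 (y : N)) x w)
    {ε κ₀ : ℝ} (hε : 0 < ε) (hK : IsClosed {x | x ∈ V ∧ r2 x ≤ 2 * ε})
    (hshell : ∀ x ∈ V, x ∈ U → r2 x ≤ 2 * ε → x ∈ W)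
    (hfar : ∃ x : N, x ∈ V → 2 * ε < r2 x)
    (hκ : ∀ x : W, (x : N) ∈ V → ε ≤ r2 x → r2 x ≤ 2 * ε →
      θ (TopologicalSpace.Opens.inclusion hWU x) ![X x] -
        mextDeriv (MForm.ofFun (𝓡 4) h) (x : N) ![X x] = κ₀ + r2 x / 2) :
    κ₀ < 0 := by
  classical
  by_contra hκ0
  rw [not_lt] at hκ0
  -- (0) a point of `U` far out
  obtain ⟨x₀, hx₀⟩ := hfar
  have hx₀U : x₀ ∈ U := by
    by_contra hxU
    have hxV : x₀ ∈ V := hUV hxU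
    have h2 : 2 * ε < r2 x₀ := hx₀ hxV
    exact hxU ((hr2U x₀ hxV).1 (by linarith))
  set w₀ : U := ⟨x₀, hx₀U⟩ with hw₀
  -- (1) the cut-off
  obtain ⟨χ, g, hχs, hgs, hgrs, hχnn, hgnn, hχ0, hχ1, hgsupp, hdχ, hdχ0⟩ :=
    exists_shell_cutoff (I := 𝓡 4) r2 hV hr2 hε hK
  -- (2) forms on `↥U`
  have hval : ContMDiff (𝓡 4) (𝓡 4) ∞ (Subtype.val : U → N) := contMDiff_subtype_val
  set sU : MForm (𝓡 4) U ℝ 2 := s.pullback (𝓡 4) (Subtype.val : U → N) with hsU_def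
  have hsU : sU ∈ closedSmoothForms (𝓡 4) U ℝ 2 := pullback_mem_closedSmoothForms hval hs
  have hsUcl : mextDeriv sU = 0 := hsU.2
  set Hf : MForm (𝓡 4) U ℝ 0 := MForm.ofFun (𝓡 4) (h ∘ Subtype.val) with hHf_def
  have hHf : IsSmoothForm Hf := fun x ↦
    MForm.smoothAt_ofFun_of_contMDiffAt ((hh (x : N) x.2).comp x (hval x))
  set H : MForm (𝓡 4) U ℝ 1 := mextDeriv Hf with hH_def
  have hHs : IsSmoothForm H := fun x ↦ MForm.SmoothAt.mextDeriv (Eventually.of_forall hHf)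
  set θ' : MForm (𝓡 4) U ℝ 1 := θ - H with hθ'_def
  have hθ's : IsSmoothForm θ' := fun x ↦ (hθ x).sub (hHs x)
  have hdθ' : mextDeriv θ' = sU := by
    have h1 : θ' = θ + -H := sub_eq_add_neg θ H
    have hnegH : IsSmoothForm (-H) := fun x ↦ (hHs x).neg
    have hdd : mextDeriv H = 0 := by
      funext x
      exact mextDeriv_mextDeriv_of_smoothAt (Eventually.of_forall hHf)
    rw [h1, mextDeriv_add hθ hnegH, mextDeriv_neg, hdθ, hdd, neg_zero, add_zero]
  obtain ⟨Θ₀, hΘ₀_def⟩ : ∃ Θ₀ : MForm (𝓡 4) U ℝ (1 + 2), Θ₀ = θ'.wedge sU := ⟨_, rfl⟩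
  have hΘ₀s : IsSmoothForm Θ₀ := by
    haveI := wedgeFacts_four (N := U)
    rw [hΘ₀_def]
    exact isSmoothForm_wedge hθ's hsU.1
  have hdΘ₀ : mextDeriv Θ₀ = (sU.wedge sU).castDeg (Nat.add_right_comm 1 1 2) := by
    haveI := wedgeFacts_four (N := U)
    rw [hΘ₀_def, mextDeriv_wedge hθ's hsU.1, hdθ', hsUcl, MForm.wedge_zero, smul_zero, add_zero]
  have hχUs : ContMDiff (𝓡 4) 𝓘(ℝ, ℝ) ∞ (χ ∘ Subtype.val : U → ℝ) := hχs.comp hval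
  obtain ⟨Θ, hΘ_def⟩ : ∃ Θ : MForm (𝓡 4) U ℝ (1 + 2), Θ = (χ ∘ Subtype.val : U → ℝ) • Θ₀ :=
    ⟨_, rfl⟩
  have hΘs : IsSmoothForm Θ := by
    rw [hΘ_def]
    exact IsSmoothForm.fun_smul' hχUs hΘ₀s
  -- (3) the global `3`-form
  obtain ⟨η, hη_def⟩ : ∃ η : MForm (𝓡 4) N ℝ (1 + 2), η = Θ.extendOpensReal w₀ := ⟨_, rfl⟩
  have hoff : ∀ m, m ∉ (U : Set N) → m ∈ V ∧ r2 m ≤ 0 := fun m hm ↦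
    ⟨hUV hm, not_lt.1 fun h0 ↦ hm ((hr2U m (hUV hm)).1 h0)⟩
  obtain ⟨O, hO_def⟩ : ∃ O : Set N, O = V ∩ r2 ⁻¹' Iio ε := ⟨_, rfl⟩
  have hO : IsOpen O := by
    have hc : ContinuousOn r2 V := fun z hz ↦ (hr2 z hz).continuousAt.continuousWithinAt
    rw [hO_def]
    exact hc.isOpen_inter_preimage hV isOpen_Iio
  have hOV : ∀ z ∈ O, z ∈ V ∧ r2 z < ε := fun z hz ↦ by
    rw [hO_def] at hz
    exact ⟨hz.1, hz.2⟩
  have hmemO : ∀ z, z ∈ V → r2 z < ε → z ∈ O := fun z h1 h2 ↦ by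
    rw [hO_def]
    exact ⟨h1, h2⟩
  have hχO : ∀ z ∈ O, χ z = 0 := fun z hz ↦ hχ0 z (hOV z hz).1 (le_of_lt (hOV z hz).2)
  have hgO : ∀ z ∈ O, g z = 0 := fun z hz ↦ by
    by_contra hgz
    exact absurd (hgsupp z hgz).2.1 (not_le.2 (hOV z hz).2)
  have hΘO : ∀ z ∈ O, ∀ hz : z ∈ U, Θ ⟨z, hz⟩ = 0 := fun z hzO hz ↦ by
    rw [hΘ_def, Pi.smul_apply', Function.comp_apply, hχO z hzO, zero_smul]
  have hOmem : ∀ m, m ∉ (U : Set N) → O ∈ 𝓝 m := fun m hm ↦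
    hO.mem_nhds (hmemO m (hoff m hm).1 (lt_of_le_of_lt (hoff m hm).2 hε))
  have hηs : IsSmoothForm η := by
    intro m
    rw [hη_def]
    by_cases hm : m ∈ U
    · exact MForm.smoothAt_extendOpensReal hm (hΘs ⟨m, hm⟩)
    · refine MForm.smoothAt_extendOpensReal_of_eventually_eq_zero ?_
      filter_upwards [hOmem m hm] with z hz hzU
      exact hΘO z hz hzU
  have hη0 : ∀ m, m ∉ (U : Set N) →
      ∀ᶠ z in 𝓝 m, η z = (0 : MForm (𝓡 4) N ℝ (1 + 2)) z := by
    intro m hm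
    filter_upwards [hOmem m hm] with z hz
    by_cases hzU : z ∈ U
    · ext v
      rw [hη_def, MForm.extendOpensReal_apply_of_mem Θ hzU, hΘO z hz hzU]
      rfl
    · rw [hη_def]
      exact MForm.extendOpensReal_apply_of_notMem Θ hzU
  -- (4) the volume form and the coefficient `F`
  obtain ⟨T, hT_def⟩ : ∃ T : MForm (𝓡 4) N ℝ 4, T = (s.wedge s).castDeg two_add_two_eq_four :=
    ⟨_, rfl⟩
  have hT : IsSmoothForm T := hT_def ▸ (wedge_self_castDeg_mem_closedSmoothForms hs).1
  have hTne : ∀ x, T x ≠ 0 := hT_def ▸ wedge_self_castDeg_apply_ne_zero s hnd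
  obtain ⟨F, hF_def⟩ : ∃ F : N → ℝ, F = fun x ↦ χ x + κ₀ * g x + (1 / 2) * (g x * r2 x) :=
    ⟨_, rfl⟩
  have hFx : ∀ x, F x = χ x + κ₀ * g x + (1 / 2) * (g x * r2 x) := fun x ↦ by rw [hF_def]
  have hFs : ContMDiff (𝓡 4) 𝓘(ℝ, ℝ) ∞ F := by
    have h3 : ContMDiff (𝓡 4) 𝓘(ℝ, ℝ × (ℝ × ℝ)) ∞ fun x ↦ (χ x, (g x, g x * r2 x)) :=
      hχs.prodMk_space (hgs.prodMk_space hgrs)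
    have hP : ContDiff ℝ ∞ fun p : ℝ × (ℝ × ℝ) ↦ p.1 + κ₀ * p.2.1 + (1 / 2) * p.2.2 := by
      fun_prop
    rw [hF_def]
    exact hP.comp_contMDiff h3
  have hgr : ∀ x, 0 ≤ g x * r2 x := by
    intro x
    by_cases hgx : g x = 0
    · rw [hgx, zero_mul]
    · have h := hgsupp x hgx
      exact mul_nonneg (hgnn x) (by linarith [h.2.1])
  have hF0 : ∀ x, 0 ≤ F x := fun x ↦ by
    have h1 := hχnn x
    have h2 := mul_nonneg hκ0 (hgnn x)
    have h3 := hgr x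
    rw [hFx]
    positivity
  have hF1 : ∃ x, 0 < F x := by
    refine ⟨x₀, ?_⟩
    have h1 : χ x₀ = 1 := hχ1 x₀ fun hxV ↦ (hx₀ hxV).le
    have h2 := mul_nonneg hκ0 (hgnn x₀)
    have h3 := hgr x₀
    rw [hFx, h1]
    positivity
  -- (5) `dη = F • T`, pointwise
  have hsUx : ∀ x : U, (sU x : (EuclideanSpace ℝ (Fin 4)) [⋀^Fin 2]→L[ℝ] ℝ) = s (x : N) := by
    intro x
    ext w
    exact MForm.pullback_subtypeVal_apply s x w
  have h4 : Module.finrank ℝ (EuclideanSpace ℝ (Fin 4)) = 4 := finrank_euclideanSpace_fin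
  have hdη : ∀ (m : N) (v : Fin 4 → EuclideanSpace ℝ (Fin 4)),
      mextDeriv η m v = (F • T) m v := by
    intro m v
    by_cases hm : m ∈ U
    · -- reduce to `↥U`
      set x : U := ⟨m, hm⟩ with hx
      have hred : mextDeriv η m v = mextDeriv Θ x v := by
        have h1 := mextDeriv_pullback_subtypeVal_apply (I := 𝓡 4) (β := η) (x := x) (hηs m) v
        rw [hη_def, MForm.pullback_subtypeVal_extendOpensReal] at h1
        rw [hη_def]
        exact h1.symm
      -- Leibniz for `χ • Θ₀`
      have hρ : MDifferentiableAt (𝓡 4) 𝓘(ℝ, ℝ) (χ ∘ Subtype.val : U → ℝ) x :=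
        (hχUs x).mdifferentiableAt (by simp)
      have hleib := mextDeriv_fun_smul_apply (I := 𝓡 4) hρ (hΘ₀s x) v
      -- the chart differential of `χ ∘ val` is `dχ`
      obtain ⟨ℓ, hℓ_def⟩ : ∃ ℓ : EuclideanSpace ℝ (Fin 4) →L[ℝ] ℝ,
          ℓ = fderivWithin ℝ ((χ ∘ Subtype.val : U → ℝ) ∘ (extChartAt (𝓡 4) x).symm)
            (range (𝓡 4)) (extChartAt (𝓡 4) x x) := ⟨_, rfl⟩
      have hℓ : ∀ w, ℓ w = mfderiv (𝓡 4) 𝓘(ℝ, ℝ) χ m w := by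
        intro w
        have h1 : mextDeriv (MForm.ofFun (𝓡 4) (χ ∘ Subtype.val : U → ℝ)) x ![w] = ℓ (![w] 0) := by
          rw [hℓ_def]
          exact mextDeriv_ofFun_apply _ x ![w]
        have h2 : mextDeriv (MForm.ofFun (𝓡 4) (χ ∘ Subtype.val : U → ℝ)) x ![w] =
            mfderiv (𝓡 4) 𝓘(ℝ, ℝ) (χ ∘ Subtype.val : U → ℝ) x (![w] 0) :=
          mextDeriv_ofFun_apply_eq_mfderiv hρ ![w]
        have h3 : mfderiv (𝓡 4) 𝓘(ℝ, ℝ) (χ ∘ Subtype.val : U → ℝ) x w =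
            mfderiv (𝓡 4) 𝓘(ℝ, ℝ) χ m w :=
          mfderiv_comp_val_real x ((hχs m).mdifferentiableAt (by simp)) w
        have h0 : (![w] : Fin 1 → EuclideanSpace ℝ (Fin 4)) 0 = w := rfl
        rw [h0] at h1 h2
        rw [← h1, h2, h3]
      -- retype the pointwise values on the model space
      obtain ⟨sm, hsm⟩ : ∃ sm : (EuclideanSpace ℝ (Fin 4)) [⋀^Fin 2]→L[ℝ] ℝ, sm = s m := ⟨_, rfl⟩
      obtain ⟨tx, htx⟩ : ∃ tx : (EuclideanSpace ℝ (Fin 4)) [⋀^Fin 1]→L[ℝ] ℝ, tx = θ' x := ⟨_, rfl⟩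
      have hsmw : ∀ u : Fin 2 → EuclideanSpace ℝ (Fin 4), sm u = s m u := fun u ↦
        congrArg (fun f : (EuclideanSpace ℝ (Fin 4)) [⋀^Fin 2]→L[ℝ] ℝ ↦ f u) hsm
      -- the `dχ ∧ θ' ∧ ω` term
      have hW : wedgeOne ℓ (tx.wedge sm) = (g m * (κ₀ + r2 m / 2)) • (sm.wedge sm) := by
        by_cases hgm : g m = 0
        · have hℓ0 : ℓ = 0 := by
            refine ContinuousLinearMap.ext fun w ↦ ?_
            rw [hℓ w]
            show mfderiv (𝓡 4) 𝓘(ℝ, ℝ) χ m w = 0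
            by_cases hmV : m ∈ V
            · rw [hdχ m hmV, hgm, zero_smul]
              rfl
            · rw [hdχ0 m hmV]
              rfl
          have hW0 : wedgeOne ℓ (tx.wedge sm) = 0 := by
            ext u
            rw [wedgeOne_apply, hℓ0]
            simp
          rw [hW0, hgm, zero_mul, zero_smul]
        · obtain ⟨hmV, hε1, hε2⟩ := hgsupp m hgm
          have hmW : m ∈ W := hshell m hmV hm hε2
          set x' : W := ⟨m, hmW⟩ with hx'
          have hr2m : MDifferentiableAt (𝓡 4) 𝓘(ℝ, ℝ) r2 m :=
            (hr2 m hmV).mdifferentiableAt (by simp)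
          -- `d r² = -2 ω(X, ·)` on the shell
          have hρw : ∀ w, @id ℝ (mfderiv (𝓡 4) 𝓘(ℝ, ℝ) r2 m w) = -2 * sm ![X x', w] := by
            intro w
            have h1 := hT4 x' w
            have h2 := mfderiv_const_mul_comp_val (-(1 / 2) : ℝ) x' hr2m w
            have h3 : sm ![X x', w] = -(1 / 2) * @id ℝ (mfderiv (𝓡 4) 𝓘(ℝ, ℝ) r2 m w) := by
              rw [hsmw, ← h2]; exact h1
            linarith
          have hℓ' : ∀ w, ℓ w = -2 * g m * sm ![X x', w] := by
            intro w
            rw [hℓ w, hdχ m hmV]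
            show g m * @id ℝ (mfderiv (𝓡 4) 𝓘(ℝ, ℝ) r2 m w) = _
            rw [hρw w]
            ring
          rw [wedgeOne_wedge_eq_smul_wedge_self h4 ℓ tx sm (hX0 x') (g m) hℓ']
          -- `θ'(X) = κ₀ + r²/2`
          have hθ'X : tx ![X x'] = κ₀ + r2 m / 2 := by
            have hk := hκ x' hmV hε1 hε2
            have hincl : TopologicalSpace.Opens.inclusion hWU x' = x := Subtype.ext rfl
            rw [hincl] at hk
            have hHX : H x ![X x'] = mextDeriv (MForm.ofFun (𝓡 4) h) m ![X x'] := by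
              have hd1 : MDifferentiableAt (𝓡 4) 𝓘(ℝ, ℝ) (h ∘ Subtype.val : U → ℝ) x :=
                ((hh m hm).comp x (hval x)).mdifferentiableAt (by simp)
              rw [hH_def, hHf_def, mextDeriv_ofFun_apply_eq_mfderiv hd1,
                mextDeriv_ofFun_apply_eq_mfderiv ((hh m hm).mdifferentiableAt (by simp))]
              exact mfderiv_comp_val_real x ((hh m hm).mdifferentiableAt (by simp)) _
            have hsub : tx ![X x'] = θ x ![X x'] - H x ![X x'] := by rw [htx]; rfl
            rw [hsub, hHX]
            exact hk
          rw [hθ'X]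
      -- assemble
      have hΘ₀x : (show (EuclideanSpace ℝ (Fin 4)) [⋀^Fin (1 + 2)]→L[ℝ] ℝ from Θ₀ x) =
          tx.wedge sm := by
        rw [hΘ₀_def, htx, hsm, ← hsUx x]
        rfl
      have hdΘ₀x : mextDeriv Θ₀ x v = (sm.wedge sm) v := by
        rw [hdΘ₀, MForm.castDeg_apply, MForm.wedge_apply, hsUx x, hsm]
        congr 1
      have hTx : T m v = (sm.wedge sm) v := by
        rw [hT_def, MForm.castDeg_apply, MForm.wedge_apply, hsm]
        congr 1
      have hWv : wedgeOne ℓ (show (EuclideanSpace ℝ (Fin 4)) [⋀^Fin (1 + 2)]→L[ℝ] ℝ from Θ₀ x) v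
          = g m * (κ₀ + r2 m / 2) * (sm.wedge sm) v := by
        rw [hΘ₀x, hW, ContinuousAlternatingMap.smul_apply, smul_eq_mul]
      have hR : (F • T) m v = F m * (sm.wedge sm) v := by
        rw [Pi.smul_apply']
        show F m • (T m v) = _
        rw [hTx, smul_eq_mul]
      have hxm : (x : N) = m := rfl
      rw [hred, hΘ_def, hleib, ← hℓ_def, hWv, hdΘ₀x, hR, Function.comp_apply, hxm, hFx,
        smul_eq_mul]
      ring
    · -- off `U`: both sides vanish
      have h0 : mextDeriv η m = 0 := by
        rw [mextDeriv_congr_of_eventuallyEq (hη0 m hm), mextDeriv_zero]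
        rfl
      have hmO : m ∈ O := hmemO m (hoff m hm).1 (lt_of_le_of_lt (hoff m hm).2 hε)
      have hFm : F m = 0 := by
        rw [hFx, hχO m hmO, hgO m hmO]
        ring
      rw [h0, Pi.smul_apply', hFm, zero_smul]
  -- (6) contradiction with Stokes
  have heq : (show MForm (𝓡 4) N ℝ 4 from mextDeriv η) = F • T := by
    funext m
    ext v
    exact hdη m v
  have hex : (show MForm (𝓡 4) N ℝ 4 from mextDeriv η) ∈ exactSmoothForms (𝓡 4) N ℝ 4 := by
    show mextDeriv η ∈ exactSmoothForms (𝓡 4) N ℝ (1 + 2 + 1)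
    exact Submodule.subset_span ⟨η, (mem_smoothForms_iff η).2 hηs, rfl⟩
  rw [heq] at hex
  exact MForm.not_mem_exactSmoothForms_smul_of_forall_ne_zero hT hTne hFs hF0 hF1 hex

end Literature.Geometry.Symplectic
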